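import Literature.AlgebraicGeometry.Motives.AbelianVarietyTateModuleAlong
import Literature.AlgebraicGeometry.Motives.AbelianVarietyCotangentBaseChangeIso
import Literature.NumberTheory.GaloisRepresentations.AbsGaloisGroup
import HarnessLib

/-!
# The Tate module under a finite (or any) extension of the ground field:
# `T_ℓ(A) ≃ T_ℓ(A ×_K E)`, naturally in `Hom` and `Γ_E → Γ_K`-equivariantly

Topic `Literature/AlgebraicGeometry/Motives`, namespace `Literature.AlgebraicGeometry.Motives.AbelianVariety`.
ONE definition with body (`tateModuleBaseChangeEquivOfEmb`) and THEOREMS, all proved; no named fact, no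
instance, no notation (net Literature debt 0).  Written for the cell `hodgecm-mathlib` (D-0151), fan A / T5
(Faltings' isogeny theorem, row VI-1), as the first brick of the base-change half «one may replace `K` by a
finite extension» of [Faltings 1983, §5] (proof of Satz 4; Tate 1966 §2 for the same remark): the routine
identification «`T_ℓ(A)` is a `Gal(Ē/E)`-module via `Gal(Ē/E) → Gal(K̄/K)`, and as such it is the Tate module
of `A ×_K E`» (Serre–Tate 1968, §1; Silverman, *AEC*, VII §4 for elliptic curves — the tree's
`EllipticCurves.tateModuleEquivOfEmb`, file `EllipticCurves/TateModuleBaseChange`, of which this file is the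
abelian-variety twin).

For an abelian variety `A` over a field `K` of characteristic `0`, a field `E ⊇ K` (`[Algebra K E]`, ANY
extension: finiteness is not used) and an embedding of algebraic closures `K̄ → Ē` over `K`, carried — exactly
as in `Motives/AbelianVarietyTateModuleAlong` — as instance PARAMETERS
`[Algebra (AlgebraicClosure K) (AlgebraicClosure E)] [IsScalarTower K (AlgebraicClosure K) (AlgebraicClosure E)]`
(the tree's chosen embedding is `GaloisRepresentations.absClosureEmbedding K E`, with the local instances
`absClosureAlgebra K E` / `absClosure_isScalarTower K E`, which §4 supplies by `letI`):

* §1 `S`-valued points along the tower `K → E → S` (`S` a field over `E`): the ★ transport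
  `pointsEquivOfTower E A S : A(S) ≃ A_E(S)` (`Motives/AbelianVarietyCotangentBaseChangeIso`, the adjunction
  `Over.map ⊣ Over.pullback`) is multiplicative (`pointsEquivOfTower_mul`), natural in homomorphisms
  `f : A ⟶ B` against `Hom.baseChange E f` (`pointsEquivOfTower_map`) and `Aut(S/E)`-equivariant for the
  Galois actions on `A(S)` (through `Aut(S/E) → Aut(S/K)`) and on `A_E(S)` (`pointsEquivOfTower_smul`).
* §2 **`tateModuleBaseChangeEquivOfEmb A E ℓ : A.tateModule ℓ ≃ₗ[ℤ_[ℓ]] (A.baseChange E).tateModule ℓ`** —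
  `T_ℓ(A) = lim A[ℓ^r](K̄) ⥲ lim A[ℓ^r](Ē) ⥲ lim A_E[ℓ^r](Ē) = T_ℓ(A_E)`: the ★ leg
  `tateModuleExtendEquiv A Ē ℓ` of `AbelianVarietyTateModuleAlong` (`T_ℓ` of `A(K̄) → A(Ē)`, onto the
  `ℓ`-power torsion) followed by `T_ℓ` of §1's `A(Ē) ≃ A_E(Ē)`; components `toMul ((e a)_r) = ((a_r)_Ē)_{A_E}`
  (`toMul_proj_tateModuleBaseChangeEquivOfEmb`).
* §3 (i) NATURALITY `e_B (T_ℓ(f) a) = T_ℓ(f_E) (e_A a)` (`tateModuleBaseChangeEquivOfEmb_tateModuleMap`), i.e.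
  `T_ℓ(f_E) = e_B ∘ T_ℓ(f) ∘ e_A⁻¹` (`tateModuleMap_baseChange_eq_conj`); (ii) EQUIVARIANCE: if `σ ∈ Γ_E`
  and `g ∈ Γ_K` are compatible along `K̄ → Ē` (`σ ∘ ι = ι ∘ g`) then `e (ρ_A(g) a) = ρ_{A_E}(σ) (e a)`
  (`tateModuleBaseChangeEquivOfEmb_tateRep_of_compatible`), parameter-free through Mathlib's
  `AlgEquiv.restrictNormal` (`tateModuleBaseChangeEquivOfEmb_tateRep_restrictNormal`); consequently the conjugate
  `e_B ∘ g ∘ e_A⁻¹` of a `Γ_K`-equivariant `ℤ_ℓ`-linear map `T_ℓ A → T_ℓ B` is `Γ_E`-equivariant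
  (`conj_smul_of_forall_smul`) and the Tate maps of `(A, B)` and `(A_E, B_E)` form a commutative square with
  `f ↦ f_E` (`toLinearMap_faltingsTateMap_baseChange`).
* §4 For the tree's CHOSEN embedding: `e (absGaloisRestrict K E σ • a) = σ • e a`
  (`tateModuleBaseChangeEquivOfEmb_absGaloisRestrict_smul`): `e` intertwines the restriction of `ρ_{A,ℓ}` along
  ★ `GaloisRepresentations.absGaloisRestrict K E : Γ_E →ₜ* Γ_K` with `ρ_{A_E,ℓ}`.

Characteristic `0` is inherited from the ★ leg `tateModuleExtendEquiv` (typed under `[CharZero K]`); it is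
used only through `(ℓ^r : K) ≠ 0`.  The descent corollary for Faltings' theorem
(`faltings_tate_bijective (A.baseChange E) (B.baseChange E) ℓ → faltings_tate_bijective A B ℓ`, `E/K` finite
normal) is NOT in this file (it needs Galois descent of homomorphisms; second brick).

## References

* [SerreTate1968] J.-P. Serre, J. Tate, *Good reduction of abelian varieties*, Ann. of Math. 88 (1968), §1
  p. 493 (`T_ℓ(A)` as a `Gal(K_s/K)`-module inside `A(K_s)`; restriction to subgroups).
* [Faltings1983Endlichkeit] G. Faltings, *Endlichkeitssätze für abelsche Varietäten über Zahlkörpern*,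
  Invent. Math. 73 (1983), §5, proof of Satz 4 («wir dürfen `K` durch eine endliche Erweiterung ersetzen»).
* [SilvermanAEC2009] J. H. Silverman, *The Arithmetic of Elliptic Curves*, 2nd ed., III §7, VII §4.
* [Lang1982AbelianFunctions] S. Lang, *Introduction to Algebraic and Abelian Functions*, 2nd ed. (1982),
  Ch. VII §1–§2 (functoriality of `T_ℓ`).
* [GortzWedhorn2020] U. Görtz, T. Wedhorn, *Algebraic Geometry I*, 2nd ed. (2020), (4.7), Remark 6.12 (1)
  (`X(S) = X_{S'}(S)` functorially), (14.20) (Galois action on points of a base change).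
* [MilneFT2022] J. S. Milne, *Fields and Galois Theory*, Ch. 7 (restriction `Gal(Ē/E) → Gal(K̄/K)`).
-/

noncomputable section

open CategoryTheory CategoryTheory.Limits Function AlgebraicGeometry
open Literature.NumberTheory.EllipticCurves (TateModule)

universe u

namespace Literature.AlgebraicGeometry.Motives.AbelianVariety

open scoped MonObj Obj TensorProduct

/-! ## §1 Points with values in a field over `E`: `A(S) ≃ A_E(S)` is a multiplicative, natural,
Galois-equivariant bijection -/

section TowerPoints

open AlgPoints

variable {K : Type u} [Field K] (E : Type u) [Field E] [Algebra K E] (A : AbelianVariety K) {B : AbelianVariety K}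
  (S : Type u) [Field S] [Algebra K S] [Algebra E S] [IsScalarTower K E S]

/-- `pointsEquivOfTower` in terms of the unit of the adjunction `Over.map ⊣ Over.pullback`:
`P ↦ η ≫ (P|restricted)_E` (the formula of ★ `pointsEquiv_apply` for a general field `S` over `E`).
[cite: GortzWedhorn2020, Section (4.7) and Remark 6.12 (1) (p. 188)] -/
theorem pointsEquivOfTower_apply (P : A.Points S) :
    pointsEquivOfTower E A S P = (Over.mapPullbackAdj (bcSpec K E)).unit.app (specOver E S) ≫
      (bcFunctor K E).map ((specOverIsoMapObjOfTower E S).inv ≫ P) := by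
  simp only [pointsEquivOfTower, Equiv.trans_apply, Iso.homCongr_apply, Iso.refl_hom, Category.comp_id]
  rfl

/-- **`A(S) ≃ A_E(S)` is multiplicative**: the group law of `A_E` is the base change of that of `A`
(Mathlib `Functor.map_mul` for the monoidal functor `Over.pullback`, bilinearity of composition
`MonObj.comp_mul`; the proof of ★ `pointsEquiv_mul` verbatim). [cite: GortzWedhorn2020, Section (4.7) and Remark 6.12 (1) (p. 188)] -/
theorem pointsEquivOfTower_mul (P Q : A.Points S) :
    pointsEquivOfTower E A S (P * Q) = pointsEquivOfTower E A S P * pointsEquivOfTower E A S Q := by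
  rw [pointsEquivOfTower_apply, pointsEquivOfTower_apply, pointsEquivOfTower_apply, MonObj.comp_mul,
    Functor.map_mul]
  exact MonObj.comp_mul _ _ _

variable {E A S} in
omit [Algebra K S] [IsScalarTower K E S] in
/-- Two `S`-points of `A_E` with the same composite to `A` are equal (both lie over `Spec S → Spec E`).
[cite: GortzWedhorn2020, Section (4.7) and Remark 6.12 (1) (p. 188)] -/
theorem TowerPoints.ext_of_comp_bcFst {Q₁ Q₂ : (A.baseChange E).Points S}
    (h : Q₁.left ≫ bcFst E A = Q₂.left ≫ bcFst E A) : Q₁ = Q₂ := by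
  ext : 1
  rw [bcFst_def] at h
  apply pullback.hom_ext
  · exact h
  · have h₁ : Q₁.left ≫ (A.baseChange E).X.hom = (specOver E S).hom := Over.w Q₁
    have h₂ : Q₂.left ≫ (A.baseChange E).X.hom = (specOver E S).hom := Over.w Q₂
    exact h₁.trans h₂.symm

variable {A} in
/-- **Naturality of `A(S) ≃ A_E(S)` in `A`**: `(f P)_E = f_E (P_E)` for `f : A ⟶ B` (both `S`-points of `B_E` lie
over `P ≫ f`). [cite: GortzWedhorn2020, Section (4.7) and Remark 6.12 (1) (p. 188)] -/
theorem pointsEquivOfTower_map (f : A ⟶ B) (P : A.Points S) :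
    pointsEquivOfTower E B S (AlgPoints.map f.hom.hom.hom P) =
      AlgPoints.map (Hom.baseChange E f).hom.hom.hom (pointsEquivOfTower E A S P) := by
  apply TowerPoints.ext_of_comp_bcFst
  rw [pointsEquivOfTower_apply_left_comp_bcFst, AlgPoints.map_apply, AlgPoints.map_apply, Over.comp_left,
    Over.comp_left, Category.assoc, bcFst_def]
  change _ = _ ≫ Hom.toSchemeHom (Hom.baseChange E f) ≫ _
  rw [toSchemeHom_baseChange_comp_fst]
  exact (congrArg (· ≫ Hom.toSchemeHom f) (pointsEquivOfTower_apply_left_comp_bcFst E A S P)).symm.trans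
    (Category.assoc _ _ _)

/-- **`A(S) ≃ A_E(S)` is Galois-equivariant**: for `σ ∈ Aut(S/E)`, acting on `A(S)` through `Aut(S/E) → Aut(S/K)`
and on `A_E(S)` directly, `(σ|_K • P)_E = σ • P_E` (naturality of the adjunction in the `E`-algebra map `σ`;
Görtz–Wedhorn I (14.20)). [cite: GortzWedhorn2020, Section (14.20) (Galois action on S-valued points)] -/
theorem pointsEquivOfTower_smul (σ : S ≃ₐ[E] S) (P : A.Points S) :
    pointsEquivOfTower E A S (σ.restrictScalars K • P) = σ • pointsEquivOfTower E A S P := by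
  rw [AlgPoints.smul_def, AlgPoints.smul_def]
  exact pointsEquivOfTower_naturality E A S (σ : S →ₐ[E] S) P

end TowerPoints

/-! ## §2 `T_ℓ(A) ≃ T_ℓ(A ×_K E)` along an embedding `K̄ → Ē` -/

section BaseChange

variable {K : Type u} [Field K] [CharZero K] (E : Type u) [Field E] [Algebra K E]
  [Algebra (AlgebraicClosure K) (AlgebraicClosure E)] [IsScalarTower K (AlgebraicClosure K) (AlgebraicClosure E)]
  (A : AbelianVariety K) {B : AbelianVariety K} (ℓ : ℕ) [Fact ℓ.Prime]

/-- **`T_ℓ(A) ≃ₗ[ℤ_ℓ] T_ℓ(A ×_K E)`** along an embedding of algebraic closures `K̄ → Ē` over `K` (instance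
parameters `[Algebra K̄ Ē] [IsScalarTower K K̄ Ē]`): `T_ℓ` of the injection `A(K̄) → A(Ē)`, which is onto the
`ℓ`-power torsion (the ★ leg `tateModuleExtendEquiv A Ē ℓ` of `AbelianVarietyTateModuleAlong`), followed by `T_ℓ`
of the group isomorphism `A(Ē) ≃ A_E(Ē)` (`pointsEquivOfTower`, made multiplicative by `pointsEquivOfTower_mul`
and additive on the synonym `(A.baseChange E).geomPoints`).  «`T_ℓ(A)` … as such it is the Tate module of
`A ×_K E`» — the abelian-variety twin of the tree's `EllipticCurves.tateModuleEquivOfEmb`.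
[cite: SerreTate1968, §1 p. 493] [cite: SilvermanAEC2009, VII §4 (T_ℓ(E) as a module for the decomposition group)] -/
def tateModuleBaseChangeEquivOfEmb : A.tateModule ℓ ≃ₗ[ℤ_[ℓ]] (A.baseChange E).tateModule ℓ :=
  (A.tateModuleExtendEquiv (AlgebraicClosure E) ℓ).trans
    (TateModule.mapAddEquiv ℓ
      (MulEquiv.toAdditive
        (MulEquiv.mk' (pointsEquivOfTower E A (AlgebraicClosure E))
          (pointsEquivOfTower_mul E A (AlgebraicClosure E))) :
        Additive (A.Points (AlgebraicClosure E)) ≃+ (A.baseChange E).geomPoints))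

/-- Components of `T_ℓ(A) ≃ T_ℓ(A_E)`: `toMul ((e a)_r) = ((a_r)_Ē)_{A_E}` — the `r`-th component is the
`Ē`-point of `A_E` attached to the `Ē`-point `(a_r)_Ē` of `A`. [cite: Lang1982AbelianFunctions, Ch. VII §1, p. 115] -/
theorem toMul_proj_tateModuleBaseChangeEquivOfEmb (a : A.tateModule ℓ) (r : ℕ) :
    Additive.toMul (TateModule.proj ℓ r (A.tateModuleBaseChangeEquivOfEmb E ℓ a) : (A.baseChange E).geomPoints) =
      pointsEquivOfTower E A (AlgebraicClosure E)
        (Additive.toMul (A.geomPointsExtend (AlgebraicClosure E) (TateModule.proj ℓ r a))) :=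
  rfl

/-! ## §3 Naturality in `Hom` and Galois equivariance -/

variable {A} in
/-- **Naturality: `e_B (T_ℓ(f) a) = T_ℓ(f_E) (e_A a)`** for `f : A ⟶ B`, `f_E = Hom.baseChange E f` —
`T_ℓ(A) ≃ T_ℓ(A_E)` is natural in homomorphisms (componentwise this is `(f P)_E = f_E (P_E)`,
`pointsEquivOfTower_map`, after `(f a_r)_Ē = f (a_r)_Ē`, ★ `geomPointsExtend_geomPointsMap`).
[cite: Lang1982AbelianFunctions, Ch. VII §2, Thm. 2.1, p. 116] -/
theorem tateModuleBaseChangeEquivOfEmb_tateModuleMap (f : A ⟶ B) (a : A.tateModule ℓ) :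
    B.tateModuleBaseChangeEquivOfEmb E ℓ (tateModuleMap ℓ f a) =
      tateModuleMap ℓ (Hom.baseChange E f) (A.tateModuleBaseChangeEquivOfEmb E ℓ a) := by
  refine TateModule.ext fun r ↦ ?_
  apply Additive.toMul.injective
  rw [toMul_proj_tateModuleBaseChangeEquivOfEmb, proj_tateModuleMap, proj_tateModuleMap,
    geomPointsExtend_geomPointsMap, Hom.toMul_pointsAddHom, Hom.geomPointsMap_apply,
    toMul_proj_tateModuleBaseChangeEquivOfEmb]
  exact pointsEquivOfTower_map E (AlgebraicClosure E) f _

variable {A} in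
/-- **`T_ℓ(f_E) = e_B ∘ T_ℓ(f) ∘ e_A⁻¹`**: the Tate module map of a base-changed homomorphism is the conjugate
of `T_ℓ(f)` by the identifications (reformulation of `tateModuleBaseChangeEquivOfEmb_tateModuleMap`).
[cite: Lang1982AbelianFunctions, Ch. VII §2, Thm. 2.1, p. 116] -/
theorem tateModuleMap_baseChange_eq_conj (f : A ⟶ B) :
    tateModuleMap ℓ (Hom.baseChange E f) =
      (B.tateModuleBaseChangeEquivOfEmb E ℓ : B.tateModule ℓ →ₗ[ℤ_[ℓ]] (B.baseChange E).tateModule ℓ) ∘ₗ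
        tateModuleMap ℓ f ∘ₗ
          ((A.tateModuleBaseChangeEquivOfEmb E ℓ).symm :
            (A.baseChange E).tateModule ℓ →ₗ[ℤ_[ℓ]] A.tateModule ℓ) := by
  ext b
  simp only [LinearMap.coe_comp, LinearEquiv.coe_coe, Function.comp_apply]
  rw [tateModuleBaseChangeEquivOfEmb_tateModuleMap, LinearEquiv.apply_symm_apply]

/-- **Galois equivariance for compatible pairs**: if `σ ∈ Γ_E = Gal(Ē/E)` and `g ∈ Γ_K = Gal(K̄/K)` are
compatible along the embedding `ι : K̄ → Ē` (`σ (ι x) = ι (g x)`), then `e (ρ_{A,ℓ}(g) a) = ρ_{A_E,ℓ}(σ) (e a)`: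
componentwise `((g • a_r)_Ē)_{A_E} = (σ|_K • (a_r)_Ē)_{A_E} = σ • ((a_r)_Ē)_{A_E}` by ★ `toMul_proj_tateModuleExtendEquiv_tateRep`
and `pointsEquivOfTower_smul`. [cite: SerreTate1968, §1 p. 493] [cite: MilneFT2022, Ch. 7 (restriction to the absolute Galois group of an extension)] -/
theorem tateModuleBaseChangeEquivOfEmb_tateRep_of_compatible (g : Field.absoluteGaloisGroup K)
    (σ : Field.absoluteGaloisGroup E)
    (h : ∀ x : AlgebraicClosure K,
      Field.absoluteGaloisGroup.toAlgEquiv E σ (algebraMap (AlgebraicClosure K) (AlgebraicClosure E) x) =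
        algebraMap (AlgebraicClosure K) (AlgebraicClosure E) (Field.absoluteGaloisGroup.toAlgEquiv K g x))
    (a : A.tateModule ℓ) :
    A.tateModuleBaseChangeEquivOfEmb E ℓ (A.tateRep ℓ g a) =
      (A.baseChange E).tateRep ℓ σ (A.tateModuleBaseChangeEquivOfEmb E ℓ a) := by
  refine TateModule.ext fun r ↦ ?_
  apply Additive.toMul.injective
  rw [toMul_proj_tateModuleBaseChangeEquivOfEmb, AbelianVariety.tateRep_apply_apply σ,
    TateModule.proj_smul_of_distribMulAction, AbelianVariety.toMul_smul, AlgPoints.absoluteGaloisGroup_smul_def,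
    ← AlgPoints.smul_def, toMul_proj_tateModuleBaseChangeEquivOfEmb, ← pointsEquivOfTower_smul,
    ← proj_tateModuleExtendEquiv, ← proj_tateModuleExtendEquiv,
    A.toMul_proj_tateModuleExtendEquiv_tateRep (AlgebraicClosure E) ℓ g
      ((Field.absoluteGaloisGroup.toAlgEquiv E σ).restrictScalars K) (fun x ↦ h x)]

/-- **Parameter-free form of the Galois equivariance**: for `σ ∈ Γ_E`, let `σ|_{K̄} ∈ Γ_K` be its restriction
along `K̄ → Ē` (Mathlib `AlgEquiv.restrictNormal` of `σ` viewed over `K`, read in `Γ_K` through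
`Field.absoluteGaloisGroup.toAlgEquiv`); then `e (ρ_{A,ℓ}(σ|_{K̄}) a) = ρ_{A_E,ℓ}(σ) (e a)` — «`T_ℓ(A)` is a
`Gal(Ē/E)`-module via restriction, and as such it is the Tate module of `A ×_K E`».
[cite: SerreTate1968, §1 p. 493] [cite: MilneFT2022, Ch. 7 (restriction to the absolute Galois group of an extension)] -/
theorem tateModuleBaseChangeEquivOfEmb_tateRep_restrictNormal (σ : Field.absoluteGaloisGroup E) (a : A.tateModule ℓ) :
    A.tateModuleBaseChangeEquivOfEmb E ℓ (A.tateRep ℓ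
        ((Field.absoluteGaloisGroup.toAlgEquiv K).symm
          (((Field.absoluteGaloisGroup.toAlgEquiv E σ).restrictScalars K).restrictNormal (AlgebraicClosure K))) a) =
      (A.baseChange E).tateRep ℓ σ (A.tateModuleBaseChangeEquivOfEmb E ℓ a) :=
  A.tateModuleBaseChangeEquivOfEmb_tateRep_of_compatible E ℓ _ σ (fun x ↦ by
    rw [MulEquiv.apply_symm_apply]
    exact (AlgEquiv.restrictNormal_commutes
      ((Field.absoluteGaloisGroup.toAlgEquiv E σ).restrictScalars K) (AlgebraicClosure K) x).symm) a

variable {A} in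
/-- **Conjugates of `Γ_K`-equivariant maps are `Γ_E`-equivariant**: if `g : T_ℓ A → T_ℓ B` is `ℤ_ℓ`-linear and
`Γ_K`-equivariant, then `e_B ∘ g ∘ e_A⁻¹ : T_ℓ(A_E) → T_ℓ(B_E)` is `Γ_E`-equivariant (each `σ ∈ Γ_E` acts on
`T_ℓ(A_E) ≃ T_ℓ(A)` through its restriction `σ|_{K̄} ∈ Γ_K`). This is the map-level content of «we may replace
`K` by a finite extension» in the proof of [Faltings 1983, Satz 4].
[cite: Faltings1983Endlichkeit, §5, proof of Satz 4 (p. 360)] [cite: SerreTate1968, §1 p. 493] -/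
theorem conj_tateModuleBaseChangeEquivOfEmb_smul (g : A.tateModule ℓ →ₗ[ℤ_[ℓ]] B.tateModule ℓ)
    (hg : ∀ (τ : Field.absoluteGaloisGroup K) (a : A.tateModule ℓ), g (τ • a) = τ • g a)
    (σ : Field.absoluteGaloisGroup E) (b : (A.baseChange E).tateModule ℓ) :
    B.tateModuleBaseChangeEquivOfEmb E ℓ (g ((A.tateModuleBaseChangeEquivOfEmb E ℓ).symm (σ • b))) =
      σ • B.tateModuleBaseChangeEquivOfEmb E ℓ (g ((A.tateModuleBaseChangeEquivOfEmb E ℓ).symm b)) := by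
  set τ : Field.absoluteGaloisGroup K := (Field.absoluteGaloisGroup.toAlgEquiv K).symm
    (((Field.absoluteGaloisGroup.toAlgEquiv E σ).restrictScalars K).restrictNormal (AlgebraicClosure K)) with hτ
  have hA : (A.tateModuleBaseChangeEquivOfEmb E ℓ).symm (σ • b) = τ • (A.tateModuleBaseChangeEquivOfEmb E ℓ).symm b := by
    apply (A.tateModuleBaseChangeEquivOfEmb E ℓ).injective
    rw [LinearEquiv.apply_symm_apply, ← AbelianVariety.tateRep_apply_apply τ, hτ,
      tateModuleBaseChangeEquivOfEmb_tateRep_restrictNormal, LinearEquiv.apply_symm_apply,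
      AbelianVariety.tateRep_apply_apply]
  rw [hA, hg, ← AbelianVariety.tateRep_apply_apply τ, hτ, tateModuleBaseChangeEquivOfEmb_tateRep_restrictNormal,
    AbelianVariety.tateRep_apply_apply]

variable {A} in
/-- **The Tate maps of `(A, B)` and `(A_E, B_E)` form a commutative square with `f ↦ f_E`**: for
`t ∈ ℤ_ℓ ⊗ Hom_K(A, B)`, the underlying linear map of `faltingsTateMap (A_E) (B_E) ((1 ⊗ (· )_E) t)` is the
conjugate `e_B ∘ (faltingsTateMap A B t) ∘ e_A⁻¹` (on pure tensors `c ⊗ f` this is `c • T_ℓ(f_E) = e_B ∘ (c • T_ℓ f) ∘ e_A⁻¹`,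
`tateModuleMap_baseChange_eq_conj`). Base change of homomorphisms is packaged as the additive map
`AddMonoidHom.mk' (Hom.baseChange E) (Hom.baseChange_add E)`.
[cite: Faltings1983Endlichkeit, §5, proof of Satz 4 (p. 360)] [cite: Lang1982AbelianFunctions, Ch. VII §2, Thm. 2.1, p. 116] -/
theorem toLinearMap_faltingsTateMap_baseChange (t : ℤ_[ℓ] ⊗[ℤ] (A ⟶ B)) :
    (faltingsTateMap (A.baseChange E) (B.baseChange E) ℓ
        ((AddMonoidHom.mk' (Hom.baseChange E) (Hom.baseChange_add E) :
            (A ⟶ B) →+ (A.baseChange E ⟶ B.baseChange E)).toIntLinearMap.baseChange ℤ_[ℓ] t)).toLinearMap =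
      (B.tateModuleBaseChangeEquivOfEmb E ℓ : B.tateModule ℓ →ₗ[ℤ_[ℓ]] (B.baseChange E).tateModule ℓ) ∘ₗ
        (faltingsTateMap A B ℓ t).toLinearMap ∘ₗ
          ((A.tateModuleBaseChangeEquivOfEmb E ℓ).symm : (A.baseChange E).tateModule ℓ →ₗ[ℤ_[ℓ]] A.tateModule ℓ) := by
  induction t using TensorProduct.induction_on with
  | zero =>
    rw [map_zero, map_zero, map_zero, Representation.IntertwiningMap.zero_toLinearMap,
      Representation.IntertwiningMap.zero_toLinearMap, LinearMap.zero_comp, LinearMap.comp_zero]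
  | tmul c f =>
    rw [LinearMap.baseChange_tmul, faltingsTateMap_tmul, faltingsTateMap_tmul,
      Representation.IntertwiningMap.toLinearMap_smul, Representation.IntertwiningMap.toLinearMap_smul,
      homToTate_apply, homToTate_apply, toLinearMap_tateIntertwiningMap, toLinearMap_tateIntertwiningMap,
      AddMonoidHom.coe_toIntLinearMap, AddMonoidHom.mk'_apply, tateModuleMap_baseChange_eq_conj,
      LinearMap.smul_comp, LinearMap.comp_smul]
  | add x y hx hy =>
    rw [map_add, map_add, map_add, Representation.IntertwiningMap.add_toLinearMap,
      Representation.IntertwiningMap.add_toLinearMap, hx, hy, LinearMap.add_comp, LinearMap.comp_add]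

end BaseChange

/-! ## §4 The tree's chosen embedding `K̄ → Ē`: equivariance along `absGaloisRestrict K E` -/

section ChosenEmbedding

open Literature.NumberTheory.GaloisRepresentations

variable {K : Type u} [Field K] [CharZero K] (E : Type u) [Field E] [Algebra K E]
  (A : AbelianVariety K) (ℓ : ℕ) [Fact ℓ.Prime]

/-- **Equivariance along the tree's restriction map `absGaloisRestrict K E : Γ_E →ₜ* Γ_K`** (for the CHOSEN embedding
`absClosureEmbedding K E : K̄ → Ē`, i.e. the instances `absClosureAlgebra K E` / `absClosure_isScalarTower K E` of
`GaloisRepresentations/AbsGaloisGroup`, supplied here by `letI` rather than as local instances):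
`e (res σ • a) = σ • e a` for `σ ∈ Γ_E`, `a ∈ T_ℓ A` — the identification `T_ℓ(A) ≃ T_ℓ(A_E)` intertwines the
restriction `ρ_{A,ℓ} ∘ res` with `ρ_{A_E,ℓ}` (compatibility `ι (res σ • x) = σ • ι x` is ★ `absGaloisRestrict_apply_smul`).
[cite: SerreTate1968, §1 p. 493] [cite: MilneFT2022, Ch. 7 (restriction to the absolute Galois group of an extension)] -/
theorem tateModuleBaseChangeEquivOfEmb_absGaloisRestrict_smul (σ : Field.absoluteGaloisGroup E) (a : A.tateModule ℓ) :
    letI := absClosureAlgebra K E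
    haveI := absClosure_isScalarTower K E
    A.tateModuleBaseChangeEquivOfEmb E ℓ (absGaloisRestrict K E σ • a) =
      σ • A.tateModuleBaseChangeEquivOfEmb E ℓ a := by
  letI := absClosureAlgebra K E
  haveI := absClosure_isScalarTower K E
  exact A.tateModuleBaseChangeEquivOfEmb_tateRep_of_compatible E ℓ (absGaloisRestrict K E σ) σ
    (fun x ↦ (absGaloisRestrict_apply_smul K E σ x).symm) a

/-- The same in representation form: `e ∘ ρ_{A,ℓ}(res σ) = ρ_{A_E,ℓ}(σ) ∘ e` as `ℤ_ℓ`-linear maps, for every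
`σ ∈ Γ_E` (chosen embedding). [cite: SerreTate1968, §1 p. 493] -/
theorem tateModuleBaseChangeEquivOfEmb_comp_tateRep_absGaloisRestrict (σ : Field.absoluteGaloisGroup E) :
    letI := absClosureAlgebra K E
    haveI := absClosure_isScalarTower K E
    (A.tateModuleBaseChangeEquivOfEmb E ℓ : A.tateModule ℓ →ₗ[ℤ_[ℓ]] (A.baseChange E).tateModule ℓ) ∘ₗ
        A.tateRep ℓ (absGaloisRestrict K E σ) =
      (A.baseChange E).tateRep ℓ σ ∘ₗ
        (A.tateModuleBaseChangeEquivOfEmb E ℓ : A.tateModule ℓ →ₗ[ℤ_[ℓ]] (A.baseChange E).tateModule ℓ) := by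
  letI := absClosureAlgebra K E
  haveI := absClosure_isScalarTower K E
  refine LinearMap.ext fun a ↦ ?_
  simp only [LinearMap.coe_comp, LinearEquiv.coe_coe, Function.comp_apply, AbelianVariety.tateRep_apply_apply]
  exact A.tateModuleBaseChangeEquivOfEmb_absGaloisRestrict_smul E ℓ σ a

end ChosenEmbedding

end Literature.AlgebraicGeometry.Motives.AbelianVariety

end
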